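import Summits.NavierStokesRegularity.NavierStokesRegularity.Theorems.AxisTwistDoorAveragedConeLiouvilleNULipDefs
import Summits.NavierStokesRegularity.NavierStokesRegularity.Theorems.AxisTwistDoorAveragedConeLiouvilleNUStandingTools
import Summits.NavierStokesRegularity.NavierStokesRegularity.Theorems.AxisTwistDoorAveragedConeLiouvilleNUWeakEnergyTools
import HarnessLib

/-!
# N4 / T1 piece W, brick (c): FRAMES — the `NUStandingLip` packaging of weak Lipschitz data
# (the Lipschitz twin of the packaging half of `nu_standing_of_classical`, p632808)

Route `AxisTwistDoor`, crux `AveragedConeLiouville` (stmt-NavierStokesRegularity-26889, CLOSED; the T1 programme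
re-proves the typed INPUT `NazarovUraltseva2011_positivity_propagation (EuclideanSpace ℝ (Fin 3))` at Literature
pace), kit `pub/ns-inputs/kits/N4-T1-skeleton.lean` 118454bf17607d1e, stub W = `Sig.nu_standing_of_weak`
(owner ns-in-ser-c g2; bricks (a) div-free transfer, (b) absorption + slab energy inequality = ser-c, (c) frames =
this file, ns-in-ser-a g3; plan g6 pub/ns-inputs STATUS 2026-08-28T14:12:51Z).

THE CONSTRUCTION (as in p632808, with `V` only Lipschitz and `b` only measurable). For data `(V, b)` on the open
cylinder `W = ]0,T[ × B(0,1)`, a switch-on time `t⋆`, a frame top `τ` and cut-offs `χ` (space), `ψ`, `ψ₁` (time):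
* `frameΦ χ ψ V τ (t,x) = χ(x) ψ(t+τ) V(t+τ,x)` for `t < 0`, `0` for `t ≥ 0`;
* `frameU ψ₁ b τ (t,x) = ψ₁(t+τ) b(t+τ,x)` for `t < 0`, `‖x‖ < 1`, `0` elsewhere.
With `χ ∈ C¹_c`, `0 ≤ χ ≤ 1`, `tsupport χ ⊆ B(0,1)`, `χ = 1` on `B̄(0,R')`, `2R < R'`; `ψ` continuous, `0 ≤ ψ ≤ 1`,
`ψ = 0` on `]-∞, t⋆/2]`, `ψ = 1` on `[t⋆, ∞[`; `ψ₁` measurable, `0 ≤ ψ₁ ≤ 1`, `ψ₁ = 0` on `]-∞, t⋆/4]`; and the weak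
data clauses of the typed fact (`b` jointly measurable, `‖b‖ ≤ Λ` on `W`, `V` Lipschitz and `≥ 0` on `W`), this file
proves EVERY clause of `NUStandingLip (frameΦ …) (frameU …) k R (nuDriftConst Λ)` EXCEPT the energy class, which
is taken as the hypothesis `hEC` (brick (b)): joint measurability, continuity on `{t < 0}`, nonnegativity, ONE
Lipschitz constant for all slices (`lipschitzWith_mul_of_eq_zero_off`, p635647: `χ` Lipschitz bounded and zero off
`B(0,1)`, `ψ(t+τ)V(t+τ,·)` Lipschitz and bounded on `B(0,1)` uniformly in `t`), the drift class with
`N = nuDriftConst Λ = ((Λ³|B₁|)^{4/3})` (`|frameU| ≤ Λ`, `2R < 1`), and the identification `frameΦ = V(·+τ,·)` for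
`t⋆ ≤ t+τ`, `t < 0`, `x ∈ B(0,2R)`; plus the two unfolding lemmas on the frame that brick (b) consumes
(`frameΦ_eq_of_mem_closedBall`, `frameU_eq_of_norm_lt_one`).

* `nuStandingLip_frame` — the packaging theorem; `exists_nuStandingLip_frame` — the `∃ Φ U` form matching the
  conclusion of `Sig.nu_standing_of_weak`.

WHAT THIS IS NOT: not a statement about Navier–Stokes; T1 is an INPUT (a printed theorem re-proved); the summit
stays open. [cite: NazarovUraltseva2011HarnackDivFree, §3 (arXiv:1011.1888 p. 8)] [cite: LeiRenTian2025, Lemma 2.5]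
-/

noncomputable section

-- the summit and its single sub-problem share the name (CONVENTIONS §1)
set_option linter.dupNamespace false

open MeasureTheory Set Function Filter Topology Metric Bornology
open scoped NNReal ENNReal

namespace Summit.NavierStokesRegularity.NavierStokesRegularity.Theorems.AveragedConeLiouville.NUPositivity

/-! ### The frame profile and drift (definitions) -/

/-- The frame profile `Φ(t,x) = χ(x) ψ(t+τ) V(t+τ,x)` for `t < 0` (and `0` for `t ≥ 0`) — p632808's construction. -/
def frameΦ (χ : EuclideanSpace ℝ (Fin 3) → ℝ) (ψ : ℝ → ℝ) (V : ℝ → EuclideanSpace ℝ (Fin 3) → ℝ) (τ : ℝ) :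
    ℝ → EuclideanSpace ℝ (Fin 3) → ℝ :=
  fun t x => if t < 0 then χ x * (ψ (t + τ) * V (t + τ) x) else 0

/-- The frame drift `U(t,x) = ψ₁(t+τ) b(t+τ,x)` for `t < 0`, `‖x‖ < 1` (and `0` elsewhere) — p632808's construction. -/
def frameU (ψ₁ : ℝ → ℝ) (b : ℝ → EuclideanSpace ℝ (Fin 3) → EuclideanSpace ℝ (Fin 3)) (τ : ℝ) :
    ℝ → EuclideanSpace ℝ (Fin 3) → EuclideanSpace ℝ (Fin 3) :=
  fun t x => if t < 0 ∧ ‖x‖ < 1 then ψ₁ (t + τ) • b (t + τ) x else 0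

/-- The drift constant `N(Λ) = ((Λ³ |B(0,1)|)^{4/3})` of the frames built from a drift bounded by `Λ`. -/
def nuDriftConst (Λ : ℝ) : ℝ≥0 :=
  ((ENNReal.ofReal Λ ^ (3 : ℕ) * volume (ball (0 : EuclideanSpace ℝ (Fin 3)) 1)) ^ (4 / 3 : ℝ)).toNNReal

/-! ### Unfolding lemmas -/

/-- `frameΦ` below `t = 0`. -/
theorem frameΦ_of_neg {χ : EuclideanSpace ℝ (Fin 3) → ℝ} {ψ : ℝ → ℝ} {V : ℝ → EuclideanSpace ℝ (Fin 3) → ℝ}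
    {τ t : ℝ} (ht : t < 0) (x : EuclideanSpace ℝ (Fin 3)) :
    frameΦ χ ψ V τ t x = χ x * (ψ (t + τ) * V (t + τ) x) := by
  simp only [frameΦ, if_pos ht]

/-- `frameΦ` vanishes from `t = 0` on. -/
theorem frameΦ_of_nonneg {χ : EuclideanSpace ℝ (Fin 3) → ℝ} {ψ : ℝ → ℝ} {V : ℝ → EuclideanSpace ℝ (Fin 3) → ℝ}
    {τ t : ℝ} (ht : 0 ≤ t) (x : EuclideanSpace ℝ (Fin 3)) : frameΦ χ ψ V τ t x = 0 := by
  simp only [frameΦ, if_neg (not_lt.2 ht)]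

/-- **Brick (b) consumes this:** on the frame ball where `χ = 1`, `frameΦ = ψ(t+τ) V(t+τ,·)`. -/
theorem frameΦ_eq_of_mem_closedBall {χ : EuclideanSpace ℝ (Fin 3) → ℝ} {ψ : ℝ → ℝ}
    {V : ℝ → EuclideanSpace ℝ (Fin 3) → ℝ} {τ R' t : ℝ}
    (hχ1 : ∀ x ∈ closedBall (0 : EuclideanSpace ℝ (Fin 3)) R', χ x = 1) (ht : t < 0)
    {x : EuclideanSpace ℝ (Fin 3)} (hx : x ∈ closedBall (0 : EuclideanSpace ℝ (Fin 3)) R') :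
    frameΦ χ ψ V τ t x = ψ (t + τ) * V (t + τ) x := by
  rw [frameΦ_of_neg ht, hχ1 x hx, one_mul]

/-- **Brick (b) consumes this:** inside the unit ball below `t = 0`, `frameU = ψ₁(t+τ) b(t+τ,·)`. -/
theorem frameU_eq_of_norm_lt_one {ψ₁ : ℝ → ℝ} {b : ℝ → EuclideanSpace ℝ (Fin 3) → EuclideanSpace ℝ (Fin 3)}
    {τ t : ℝ} (ht : t < 0) {x : EuclideanSpace ℝ (Fin 3)} (hx : ‖x‖ < 1) :
    frameU ψ₁ b τ t x = ψ₁ (t + τ) • b (t + τ) x := by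
  simp only [frameU, if_pos (And.intro ht hx)]

/-- `frameU` vanishes off `{t < 0} × B(0,1)`. -/
theorem frameU_eq_zero {ψ₁ : ℝ → ℝ} {b : ℝ → EuclideanSpace ℝ (Fin 3) → EuclideanSpace ℝ (Fin 3)}
    {τ t : ℝ} {x : EuclideanSpace ℝ (Fin 3)} (h : ¬ (t < 0 ∧ ‖x‖ < 1)) : frameU ψ₁ b τ t x = 0 := by
  simp only [frameU, if_neg h]

/-- **Identification on the frame:** `frameΦ(t,x) = V(t+τ,x)` for `t⋆ ≤ t+τ`, `t < 0`, `x ∈ B(0,2R)` (`χ = 1` on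
`B̄(0,R') ⊇ B(0,2R)`, `ψ = 1` on `[t⋆,∞[`). -/
theorem frameΦ_eq_of_le {χ : EuclideanSpace ℝ (Fin 3) → ℝ} {ψ : ℝ → ℝ} {V : ℝ → EuclideanSpace ℝ (Fin 3) → ℝ}
    {τ R R' tstar : ℝ} (hχ1 : ∀ x ∈ closedBall (0 : EuclideanSpace ℝ (Fin 3)) R', χ x = 1) (h2R : 2 * R ≤ R')
    (hψ1 : ∀ s, tstar ≤ s → ψ s = 1) {t : ℝ} {x : EuclideanSpace ℝ (Fin 3)} (hts : tstar ≤ t + τ) (ht : t < 0)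
    (hx : x ∈ ball (0 : EuclideanSpace ℝ (Fin 3)) (2 * R)) : frameΦ χ ψ V τ t x = V (t + τ) x := by
  rw [frameΦ_eq_of_mem_closedBall hχ1 ht (ball_subset_closedBall (ball_subset_ball h2R hx)), hψ1 _ hts, one_mul]

/-! ### The clauses of `NUStandingLip` for the frame pair -/

section Clauses

variable {χ : EuclideanSpace ℝ (Fin 3) → ℝ} {ψ ψ₁ : ℝ → ℝ} {V : ℝ → EuclideanSpace ℝ (Fin 3) → ℝ}
  {b : ℝ → EuclideanSpace ℝ (Fin 3) → EuclideanSpace ℝ (Fin 3)} {T τ tstar Λ : ℝ}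

/-- Nonnegativity of the frame profile. -/
theorem frameΦ_nonneg (hχ0 : ∀ x, 0 ≤ χ x) (hχball : tsupport χ ⊆ ball (0 : EuclideanSpace ℝ (Fin 3)) 1)
    (hψ0 : ∀ s, 0 ≤ ψ s) (hψz : ∀ s, s ≤ tstar / 2 → ψ s = 0) (htstar : 0 < tstar) (hτT : τ ≤ T)
    (hV0 : ∀ t ∈ Ioo 0 T, ∀ x ∈ ball (0 : EuclideanSpace ℝ (Fin 3)) 1, 0 ≤ V t x) (t : ℝ)
    (x : EuclideanSpace ℝ (Fin 3)) : 0 ≤ frameΦ χ ψ V τ t x := by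
  by_cases ht : t < 0
  · rw [frameΦ_of_neg ht]
    by_cases hx : x ∈ ball (0 : EuclideanSpace ℝ (Fin 3)) 1
    · by_cases hs : tstar / 2 < t + τ
      · exact mul_nonneg (hχ0 x) (mul_nonneg (hψ0 _) (hV0 _ ⟨by linarith, by linarith⟩ x hx))
      · rw [hψz _ (not_lt.1 hs), zero_mul, mul_zero]
    · rw [image_eq_zero_of_notMem_tsupport (fun h => hx (hχball h)), zero_mul]
  · rw [frameΦ_of_nonneg (not_lt.1 ht)]

/-- Continuity of the frame profile on the open half-space `{t < 0}` (there `ψ(t+τ) ≠ 0` forces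
`(t+τ, x) ∈ ]0,T[ × B(0,1)` or `χ(x) = 0` near `x`). -/
theorem continuousOn_frameΦ (hχc : Continuous χ) (hχball : tsupport χ ⊆ ball (0 : EuclideanSpace ℝ (Fin 3)) 1)
    (hψc : Continuous ψ) (hψz : ∀ s, s ≤ tstar / 2 → ψ s = 0) (htstar : 0 < tstar) (hτT : τ ≤ T)
    (hVc : ContinuousOn (uncurry V) (Ioo 0 T ×ˢ ball (0 : EuclideanSpace ℝ (Fin 3)) 1)) :
    ContinuousOn (uncurry (frameΦ χ ψ V τ)) {z : ℝ × EuclideanSpace ℝ (Fin 3) | z.1 < 0} := by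
  have hcylopen : IsOpen (Ioo 0 T ×ˢ ball (0 : EuclideanSpace ℝ (Fin 3)) 1) := isOpen_Ioo.prod isOpen_ball
  have hshift : Continuous (fun z : ℝ × EuclideanSpace ℝ (Fin 3) => (z.1 + τ, z.2)) :=
    (continuous_fst.add continuous_const).prodMk continuous_snd
  set f : ℝ × EuclideanSpace ℝ (Fin 3) → ℝ := fun z => χ z.2 * (ψ (z.1 + τ) * V (z.1 + τ) z.2) with hf
  have hfat : ∀ z : ℝ × EuclideanSpace ℝ (Fin 3), z.1 < 0 → ContinuousAt f z := by
    intro z hz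
    by_cases hA : z.1 + τ < tstar / 2
    · have ho : IsOpen {w : ℝ × EuclideanSpace ℝ (Fin 3) | w.1 + τ < tstar / 2} :=
        isOpen_lt (continuous_fst.add continuous_const) continuous_const
      have hev : f =ᶠ[𝓝 z] fun _ => 0 := by
        filter_upwards [ho.mem_nhds hA] with w hw
        simp only [hf, hψz _ (le_of_lt hw), zero_mul, mul_zero]
      exact continuousAt_const.congr_of_eventuallyEq hev
    · by_cases hB : z.2 ∈ ball (0 : EuclideanSpace ℝ (Fin 3)) 1
      · have h1 : 0 < z.1 + τ := by linarith [not_lt.mp hA]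
        have hmem : (z.1 + τ, z.2) ∈ Ioo 0 T ×ˢ ball (0 : EuclideanSpace ℝ (Fin 3)) 1 :=
          ⟨⟨h1, by linarith⟩, hB⟩
        have hVat : ContinuousAt (fun w : ℝ × EuclideanSpace ℝ (Fin 3) => V (w.1 + τ) w.2) z :=
          ContinuousAt.comp (g := uncurry V) (f := fun w : ℝ × EuclideanSpace ℝ (Fin 3) => (w.1 + τ, w.2))
            (x := z) (hVc.continuousAt (hcylopen.mem_nhds hmem)) hshift.continuousAt
        exact (hχc.continuousAt.comp continuousAt_snd).mul
          (((hψc.comp (continuous_fst.add continuous_const)).continuousAt).mul hVat)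
      · have hχz : z.2 ∉ tsupport χ := fun h => hB (hχball h)
        have hev0 : ∀ᶠ w in 𝓝 z, χ w.2 = 0 :=
          (continuous_snd.tendsto z).eventually (notMem_tsupport_iff_eventuallyEq.mp hχz)
        have hev : f =ᶠ[𝓝 z] fun _ => 0 := by
          filter_upwards [hev0] with w hw
          simp only [hf, hw, zero_mul]
        exact continuousAt_const.congr_of_eventuallyEq hev
  refine fun z hz => ((hfat z hz).continuousWithinAt).congr (fun w hw => ?_) ?_
  · simp only [uncurry, frameΦ, if_pos (show w.1 < 0 from hw), hf]
  · simp only [uncurry, frameΦ, if_pos (show z.1 < 0 from hz), hf]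

/-- Joint measurability of the frame profile. -/
theorem measurable_frameΦ (hχc : Continuous χ) (hχball : tsupport χ ⊆ ball (0 : EuclideanSpace ℝ (Fin 3)) 1)
    (hψc : Continuous ψ) (hψz : ∀ s, s ≤ tstar / 2 → ψ s = 0) (htstar : 0 < tstar) (hτT : τ ≤ T)
    (hVc : ContinuousOn (uncurry V) (Ioo 0 T ×ˢ ball (0 : EuclideanSpace ℝ (Fin 3)) 1)) :
    Measurable (uncurry (frameΦ χ ψ V τ)) :=
  measurable_of_continuousOn_of_eq_zero (isOpen_lt continuous_fst continuous_const)
    (continuousOn_frameΦ hχc hχball hψc hψz htstar hτT hVc) fun z hz => by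
      simp only [uncurry, frameΦ, if_neg (show ¬ z.1 < 0 from hz)]

/-- **One Lipschitz constant for all slices of the frame profile** (the clause that replaces the `C¹` slices of
`NUStanding`): `χ` is Lipschitz, bounded by `1` and zero off `B(0,1)`; `ψ(t+τ) V(t+τ,·)` is `L`-Lipschitz and
bounded on `B(0,1)` uniformly in `t` (a Lipschitz function on the bounded cylinder is bounded); product rule
`lipschitzWith_mul_of_eq_zero_off` (p635647). -/
theorem exists_lipschitzWith_frameΦ {Cχ : ℝ≥0} (hχL : LipschitzWith Cχ χ) (hχ01 : ∀ x, 0 ≤ χ x ∧ χ x ≤ 1)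
    (hχball : tsupport χ ⊆ ball (0 : EuclideanSpace ℝ (Fin 3)) 1)
    (hψ01 : ∀ s, 0 ≤ ψ s ∧ ψ s ≤ 1) (hψz : ∀ s, s ≤ tstar / 2 → ψ s = 0) (htstar : 0 < tstar) (hτT : τ ≤ T)
    (hVL : ∃ L, LipschitzOnWith L (uncurry V) (Ioo 0 T ×ˢ ball (0 : EuclideanSpace ℝ (Fin 3)) 1)) :
    ∃ L : ℝ≥0, ∀ t, LipschitzWith L (frameΦ χ ψ V τ t) := by
  obtain ⟨L, hL⟩ := hVL
  set W : Set (ℝ × EuclideanSpace ℝ (Fin 3)) := Ioo 0 T ×ˢ ball (0 : EuclideanSpace ℝ (Fin 3)) 1 with hW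
  -- a uniform bound for `|V|` on the (bounded) cylinder
  have hWbdd : IsBounded W := (isBounded_Ioo 0 T).prod isBounded_ball
  obtain ⟨M, hM0, hM⟩ : ∃ M : ℝ, 0 ≤ M ∧ ∀ p ∈ W, |uncurry V p| ≤ M := by
    rcases W.eq_empty_or_nonempty with hW0 | ⟨p₀, hp₀⟩
    · exact ⟨0, le_rfl, fun p hp => absurd (hW0 ▸ hp : p ∈ (∅ : Set _)) (notMem_empty _)⟩
    · obtain ⟨C, hC⟩ := Metric.isBounded_iff.1 hWbdd
      refine ⟨|uncurry V p₀| + L * max C 0, by positivity, fun p hp => ?_⟩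
      have h1 := hL.dist_le_mul p hp p₀ hp₀
      rw [Real.dist_eq] at h1
      have h2 : dist p p₀ ≤ max C 0 := (hC hp hp₀).trans (le_max_left _ _)
      have h3 := abs_sub_abs_le_abs_sub (uncurry V p) (uncurry V p₀)
      have h4 : (L : ℝ) * dist p p₀ ≤ L * max C 0 := mul_le_mul_of_nonneg_left h2 L.coe_nonneg
      linarith
  refine ⟨⟨M, hM0⟩ * Cχ + ⟨1, zero_le_one⟩ * L, fun t => ?_⟩
  by_cases ht : t < 0
  · -- the slice is `x ↦ F x * χ x` with `F = ψ(t+τ) V(t+τ,·)`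
    have e : frameΦ χ ψ V τ t = fun x => (ψ (t + τ) * V (t + τ) x) * χ x := by
      funext x; rw [frameΦ_of_neg ht, mul_comm]
    rw [e]
    have hχ0 : ∀ x, x ∉ ball (0 : EuclideanSpace ℝ (Fin 3)) 1 → χ x = 0 := fun x hx =>
      image_eq_zero_of_notMem_tsupport fun h => hx (hχball h)
    have hχb : ∀ x, |χ x| ≤ 1 := fun x => by rw [abs_of_nonneg (hχ01 x).1]; exact (hχ01 x).2
    by_cases hs : tstar / 2 < t + τ
    · have hmem : ∀ x ∈ ball (0 : EuclideanSpace ℝ (Fin 3)) 1, (t + τ, x) ∈ W := fun x hx =>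
        ⟨⟨by linarith, by linarith⟩, hx⟩
      have hF : LipschitzOnWith L (fun x => ψ (t + τ) * V (t + τ) x) (ball (0 : EuclideanSpace ℝ (Fin 3)) 1) := by
        refine LipschitzOnWith.of_dist_le_mul fun x hx y hy => ?_
        have h1 := hL.dist_le_mul (t + τ, x) (hmem x hx) (t + τ, y) (hmem y hy)
        have h2 : dist ((t + τ, x) : ℝ × EuclideanSpace ℝ (Fin 3)) (t + τ, y) = dist x y := by
          rw [Prod.dist_eq, dist_self, max_eq_right dist_nonneg]
        rw [h2] at h1
        calc dist (ψ (t + τ) * V (t + τ) x) (ψ (t + τ) * V (t + τ) y)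
            = |ψ (t + τ)| * dist (V (t + τ) x) (V (t + τ) y) := by
              rw [Real.dist_eq, Real.dist_eq, ← mul_sub, abs_mul]
          _ ≤ 1 * (L * dist x y) := by
              refine mul_le_mul ?_ h1 dist_nonneg zero_le_one
              rw [abs_of_nonneg (hψ01 _).1]; exact (hψ01 _).2
          _ = L * dist x y := one_mul _
      have hFb : ∀ x ∈ ball (0 : EuclideanSpace ℝ (Fin 3)) 1, |ψ (t + τ) * V (t + τ) x| ≤ M := by
        intro x hx
        rw [abs_mul, abs_of_nonneg (hψ01 _).1]
        calc ψ (t + τ) * |V (t + τ) x| ≤ 1 * M :=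
            mul_le_mul (hψ01 _).2 (hM _ (hmem x hx)) (abs_nonneg _) zero_le_one
          _ = M := one_mul M
      exact lipschitzWith_mul_of_eq_zero_off hχL hχb hχ0 hF hFb hM0 zero_le_one
    · have e0 : (fun x => (ψ (t + τ) * V (t + τ) x) * χ x) = fun _ => 0 := by
        funext x; rw [hψz _ (not_lt.1 hs), zero_mul, zero_mul]
      rw [e0]; exact LipschitzWith.const' 0
  · have e0 : frameΦ χ ψ V τ t = fun _ => 0 := by funext x; exact frameΦ_of_nonneg (not_lt.1 ht) x
    rw [e0]; exact LipschitzWith.const' 0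

/-- Joint measurability of the frame drift (`b` jointly measurable, `ψ₁` measurable). -/
theorem measurable_frameU (hψ₁m : Measurable ψ₁) (hbm : Measurable (uncurry b)) :
    Measurable (uncurry (frameU ψ₁ b τ)) := by
  have hset : MeasurableSet {z : ℝ × EuclideanSpace ℝ (Fin 3) | z.1 < 0 ∧ ‖z.2‖ < 1} :=
    (measurableSet_lt measurable_fst measurable_const).inter
      (measurableSet_lt (measurable_snd.norm) measurable_const)
  have hshift : Measurable (fun z : ℝ × EuclideanSpace ℝ (Fin 3) => (z.1 + τ, z.2)) :=
    (measurable_fst.add_const τ).prodMk measurable_snd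
  have hg : Measurable (fun z : ℝ × EuclideanSpace ℝ (Fin 3) => ψ₁ (z.1 + τ) • b (z.1 + τ) z.2) :=
    (hψ₁m.comp (measurable_fst.add_const τ)).smul (hbm.comp hshift)
  have e : uncurry (frameU ψ₁ b τ) = fun z : ℝ × EuclideanSpace ℝ (Fin 3) =>
      if z.1 < 0 ∧ ‖z.2‖ < 1 then ψ₁ (z.1 + τ) • b (z.1 + τ) z.2 else 0 := by
    funext z; rfl
  rw [e]
  exact Measurable.ite hset hg measurable_const

/-- The frame drift is bounded by `Λ` everywhere. -/
theorem norm_frameU_le (hΛ : 0 ≤ Λ) (hφ01 : ∀ s, 0 ≤ ψ₁ s ∧ ψ₁ s ≤ 1) (hφz : ∀ s, s ≤ tstar / 4 → ψ₁ s = 0)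
    (htstar : 0 < tstar) (hτT : τ ≤ T)
    (hbΛ : ∀ t ∈ Ioo 0 T, ∀ x ∈ ball (0 : EuclideanSpace ℝ (Fin 3)) 1, ‖b t x‖ ≤ Λ)
    (t : ℝ) (x : EuclideanSpace ℝ (Fin 3)) : ‖frameU ψ₁ b τ t x‖ ≤ Λ := by
  by_cases h : t < 0 ∧ ‖x‖ < 1
  · rw [frameU_eq_of_norm_lt_one h.1 h.2]
    by_cases hs : tstar / 4 < t + τ
    · rw [norm_smul, Real.norm_eq_abs, abs_of_nonneg (hφ01 _).1]
      calc ψ₁ (t + τ) * ‖b (t + τ) x‖ ≤ 1 * Λ :=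
          mul_le_mul (hφ01 _).2 (hbΛ _ ⟨by linarith, by linarith [h.1]⟩ x (mem_ball_zero_iff.2 h.2))
            (norm_nonneg _) zero_le_one
        _ = Λ := one_mul Λ
    · rw [hφz _ (not_lt.1 hs), zero_smul, norm_zero]; exact hΛ
  · rw [frameU_eq_zero h, norm_zero]; exact hΛ

end Clauses

/-- **The drift class from a pointwise bound** (construction-agnostic): `‖U‖ ≤ Λ` everywhere and `2R ≤ 1`
give `∫_{-R²}^0 (∫_{B(2R)} |U|³)^{4/3} ≤ N(Λ) R²` with `N(Λ) = nuDriftConst Λ`. -/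
theorem driftClass_of_norm_le {U : ℝ → EuclideanSpace ℝ (Fin 3) → EuclideanSpace ℝ (Fin 3)} {Λ R : ℝ}
    (hR : 0 < R) (h2R : 2 * R ≤ 1) (hUbd : ∀ t x, ‖U t x‖ ≤ Λ) :
    (∫⁻ s in Ioo (-R ^ 2) 0, (∫⁻ y in ball (0 : EuclideanSpace ℝ (Fin 3)) (2 * R),
      ‖U s y‖ₑ ^ (3 : ℕ)) ^ (4 / 3 : ℝ)) ≤ (nuDriftConst Λ : ℝ≥0∞) * ENNReal.ofReal R ^ 2 := by
  set C₀ : ℝ≥0∞ := ENNReal.ofReal Λ ^ (3 : ℕ) * volume (ball (0 : EuclideanSpace ℝ (Fin 3)) 1) with hC₀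
  have hC₀top : C₀ ≠ ⊤ := ENNReal.mul_ne_top (ENNReal.pow_ne_top ENNReal.ofReal_ne_top)
    measure_ball_lt_top.ne
  have hC₀' : C₀ ^ (4 / 3 : ℝ) ≠ ⊤ := ENNReal.rpow_ne_top_of_nonneg (by norm_num) hC₀top
  have hN : (nuDriftConst Λ : ℝ≥0∞) = C₀ ^ (4 / 3 : ℝ) := by
    rw [nuDriftConst, ← hC₀, ENNReal.coe_toNNReal hC₀']
  have hinner : ∀ s, (∫⁻ y in ball (0 : EuclideanSpace ℝ (Fin 3)) (2 * R), ‖U s y‖ₑ ^ (3 : ℕ)) ≤ C₀ := by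
    intro s
    calc (∫⁻ y in ball (0 : EuclideanSpace ℝ (Fin 3)) (2 * R), ‖U s y‖ₑ ^ (3 : ℕ))
        ≤ ∫⁻ _ in ball (0 : EuclideanSpace ℝ (Fin 3)) (2 * R), ENNReal.ofReal Λ ^ (3 : ℕ) :=
          setLIntegral_mono measurable_const fun y _ => by
            have h2 : ‖U s y‖ₑ ≤ ENNReal.ofReal Λ := by
              rw [← ofReal_norm]; exact ENNReal.ofReal_le_ofReal (hUbd s y)
            exact pow_le_pow_left' h2 3
      _ = ENNReal.ofReal Λ ^ (3 : ℕ) * volume (ball (0 : EuclideanSpace ℝ (Fin 3)) (2 * R)) :=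
          setLIntegral_const _ _
      _ ≤ ENNReal.ofReal Λ ^ (3 : ℕ) * volume (ball (0 : EuclideanSpace ℝ (Fin 3)) 1) := by
          gcongr
  calc (∫⁻ s in Ioo (-R ^ 2) 0, (∫⁻ y in ball (0 : EuclideanSpace ℝ (Fin 3)) (2 * R),
        ‖U s y‖ₑ ^ (3 : ℕ)) ^ (4 / 3 : ℝ))
      ≤ ∫⁻ _ in Ioo (-R ^ 2) 0, C₀ ^ (4 / 3 : ℝ) :=
        setLIntegral_mono measurable_const fun s _ => ENNReal.rpow_le_rpow (hinner s) (by norm_num)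
    _ = C₀ ^ (4 / 3 : ℝ) * volume (Ioo (-R ^ 2) (0 : ℝ)) := setLIntegral_const _ _
    _ = (nuDriftConst Λ : ℝ≥0∞) * ENNReal.ofReal R ^ 2 := by
        rw [hN, Real.volume_Ioo, ← ENNReal.ofReal_pow hR.le]
        congr 2
        ring

/-! ### The packaging theorem -/

/-- **Brick (c) of W: the `NUStandingLip` frame from weak Lipschitz data, GIVEN the energy class of the frame pair
(brick (b)).** Hypotheses: the data clauses of the typed fact (`b` jointly measurable and bounded by `Λ ≥ 0` on
`]0,T[ × B(0,1)`, `V` Lipschitz and nonnegative there), an admissible frame (`0 < k`, `0 < t⋆ < τ ≤ T`, `0 < R`,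
`2R ≤ R' < 1`), cut-offs `χ ∈ C¹_c` (`0 ≤ χ ≤ 1`, `tsupport χ ⊆ B(0,1)`, `χ = 1` on `B̄(0,R')`),
`ψ` continuous (`0 ≤ ψ ≤ 1`, `= 0` below `t⋆/2`, `= 1` above `t⋆`), `ψ₁` measurable (`0 ≤ ψ₁ ≤ 1`, `= 0` below
`t⋆/4`), and `hEC : NUEnergyClass (frameΦ χ ψ V τ) (frameU ψ₁ b τ) k R`. Conclusion: `NUStandingLip` with the
drift constant `nuDriftConst Λ`, and the identification on the frame. -/
theorem nuStandingLip_frame {χ : EuclideanSpace ℝ (Fin 3) → ℝ} {ψ ψ₁ : ℝ → ℝ}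
    {V : ℝ → EuclideanSpace ℝ (Fin 3) → ℝ} {b : ℝ → EuclideanSpace ℝ (Fin 3) → EuclideanSpace ℝ (Fin 3)}
    {T τ tstar Λ k R R' : ℝ} (hΛ : 0 ≤ Λ)
    (hbm : Measurable (uncurry b))
    (hbΛ : ∀ t ∈ Ioo 0 T, ∀ x ∈ ball (0 : EuclideanSpace ℝ (Fin 3)) 1, ‖b t x‖ ≤ Λ)
    (hVL : ∃ L, LipschitzOnWith L (uncurry V) (Ioo 0 T ×ˢ ball (0 : EuclideanSpace ℝ (Fin 3)) 1))
    (hV0 : ∀ t ∈ Ioo 0 T, ∀ x ∈ ball (0 : EuclideanSpace ℝ (Fin 3)) 1, 0 ≤ V t x)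
    (hk : 0 < k) (htstar : 0 < tstar) (hτT : τ ≤ T) (hR : 0 < R) (h2R : 2 * R ≤ R') (hR'1 : R' < 1)
    (hχ1 : ContDiff ℝ 1 χ) (hχc : HasCompactSupport χ) (hχ01 : ∀ x, 0 ≤ χ x ∧ χ x ≤ 1)
    (hχball : tsupport χ ⊆ ball (0 : EuclideanSpace ℝ (Fin 3)) 1)
    (hχone : ∀ x ∈ closedBall (0 : EuclideanSpace ℝ (Fin 3)) R', χ x = 1)
    (hψc : Continuous ψ) (hψ01 : ∀ s, 0 ≤ ψ s ∧ ψ s ≤ 1) (hψz : ∀ s, s ≤ tstar / 2 → ψ s = 0)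
    (hψ1 : ∀ s, tstar ≤ s → ψ s = 1)
    (hψ₁m : Measurable ψ₁) (hφ01 : ∀ s, 0 ≤ ψ₁ s ∧ ψ₁ s ≤ 1) (hφz : ∀ s, s ≤ tstar / 4 → ψ₁ s = 0)
    (hEC : NUEnergyClass (frameΦ χ ψ V τ) (frameU ψ₁ b τ) k R) :
    NUStandingLip (frameΦ χ ψ V τ) (frameU ψ₁ b τ) k R (nuDriftConst Λ) ∧
      ∀ t x, tstar ≤ t + τ → t < 0 → x ∈ ball (0 : EuclideanSpace ℝ (Fin 3)) (2 * R) →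
        frameΦ χ ψ V τ t x = V (t + τ) x := by
  obtain ⟨L, hL⟩ := hVL
  have hVc : ContinuousOn (uncurry V) (Ioo 0 T ×ˢ ball (0 : EuclideanSpace ℝ (Fin 3)) 1) := hL.continuousOn
  obtain ⟨Cχ, hχL⟩ : ∃ C, LipschitzWith C χ := ContDiff.lipschitzWith_of_hasCompactSupport hχc hχ1 one_ne_zero
  obtain ⟨L', hL'⟩ := exists_lipschitzWith_frameΦ (τ := τ) hχL hχ01 hχball hψ01 hψz htstar hτT ⟨L, hL⟩
  refine ⟨⟨hk, hR, measurable_frameΦ hχ1.continuous hχball hψc hψz htstar hτT hVc,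
    (measurable_frameU (τ := τ) hψ₁m hbm).aestronglyMeasurable,
    continuousOn_frameΦ hχ1.continuous hχball hψc hψz htstar hτT hVc,
    frameΦ_nonneg (fun x => (hχ01 x).1) hχball (fun s => (hψ01 s).1) hψz htstar hτT hV0,
    ⟨L', hL'⟩,
    driftClass_of_norm_le hR (by linarith) (norm_frameU_le hΛ hφ01 hφz htstar hτT hbΛ), hEC⟩,
    fun t x hts ht hx => frameΦ_eq_of_le hχone h2R hψ1 hts ht hx⟩

/-- **The `∃ Φ U` form** (shape of the conclusion of `Sig.nu_standing_of_weak`): under the hypotheses of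
`nuStandingLip_frame`, there are `Φ, U` with `NUStandingLip Φ U k R (nuDriftConst Λ)` agreeing with `V(·+τ,·)`
on the frame. -/
theorem exists_nuStandingLip_frame {χ : EuclideanSpace ℝ (Fin 3) → ℝ} {ψ ψ₁ : ℝ → ℝ}
    {V : ℝ → EuclideanSpace ℝ (Fin 3) → ℝ} {b : ℝ → EuclideanSpace ℝ (Fin 3) → EuclideanSpace ℝ (Fin 3)}
    {T τ tstar Λ k R R' : ℝ} (hΛ : 0 ≤ Λ)
    (hbm : Measurable (uncurry b))
    (hbΛ : ∀ t ∈ Ioo 0 T, ∀ x ∈ ball (0 : EuclideanSpace ℝ (Fin 3)) 1, ‖b t x‖ ≤ Λ)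
    (hVL : ∃ L, LipschitzOnWith L (uncurry V) (Ioo 0 T ×ˢ ball (0 : EuclideanSpace ℝ (Fin 3)) 1))
    (hV0 : ∀ t ∈ Ioo 0 T, ∀ x ∈ ball (0 : EuclideanSpace ℝ (Fin 3)) 1, 0 ≤ V t x)
    (hk : 0 < k) (htstar : 0 < tstar) (hτT : τ ≤ T) (hR : 0 < R) (h2R : 2 * R ≤ R') (hR'1 : R' < 1)
    (hχ1 : ContDiff ℝ 1 χ) (hχc : HasCompactSupport χ) (hχ01 : ∀ x, 0 ≤ χ x ∧ χ x ≤ 1)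
    (hχball : tsupport χ ⊆ ball (0 : EuclideanSpace ℝ (Fin 3)) 1)
    (hχone : ∀ x ∈ closedBall (0 : EuclideanSpace ℝ (Fin 3)) R', χ x = 1)
    (hψc : Continuous ψ) (hψ01 : ∀ s, 0 ≤ ψ s ∧ ψ s ≤ 1) (hψz : ∀ s, s ≤ tstar / 2 → ψ s = 0)
    (hψ1 : ∀ s, tstar ≤ s → ψ s = 1)
    (hψ₁m : Measurable ψ₁) (hφ01 : ∀ s, 0 ≤ ψ₁ s ∧ ψ₁ s ≤ 1) (hφz : ∀ s, s ≤ tstar / 4 → ψ₁ s = 0)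
    (hEC : NUEnergyClass (frameΦ χ ψ V τ) (frameU ψ₁ b τ) k R) :
    ∃ (Φ : ℝ → EuclideanSpace ℝ (Fin 3) → ℝ) (U : ℝ → EuclideanSpace ℝ (Fin 3) → EuclideanSpace ℝ (Fin 3)),
      NUStandingLip Φ U k R (nuDriftConst Λ) ∧
      ∀ t x, tstar ≤ t + τ → t < 0 → x ∈ ball (0 : EuclideanSpace ℝ (Fin 3)) (2 * R) → Φ t x = V (t + τ) x :=
  ⟨_, _, nuStandingLip_frame hΛ hbm hbΛ hVL hV0 hk htstar hτT hR h2R hR'1 hχ1 hχc hχ01 hχball hχone hψc hψ01 hψz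
    hψ1 hψ₁m hφ01 hφz hEC⟩

end Summit.NavierStokesRegularity.NavierStokesRegularity.Theorems.AveragedConeLiouville.NUPositivity

end
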